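import Summits.Parity.BatemanHorn.Theses.RoughValueTransport
import Summits.Parity.BatemanHorn.Theorems.RoughValueTransportRoughValueLawStrength
import Summits.Parity.BatemanHorn.Theorems.RoughValueTransportRoughValueLawIffRatioLaws
import HarnessLib

/-!
# Crux `RoughValueLaw` (stmt-Parity-11390) — re-audit certificate of line lead c2 (2026-08-17)

Evidence file (not a proposal).  It re-derives, from LANDED tree theorems only, the two facts on
which the c2 verdict rests:

* `openStubs_iff_crux` — the open stub set of line `increment-anchoring`
  (S4 `stub_deepRatioLaw` ∧ S5 `stub_shallowRatioLaw`, verbatim signatures) is EQUIVALENT to the crux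
  (`IncrementAnchoring.roughValueLaw_iff_ratioLaws`, p92159);
* `twinPrimes_of_openStubs` — hence any proof of those two stubs proves the twin prime conjecture
  (`Strength.twinPrimeConjecture_of_roughValueLaw`, p108123), and likewise Hardy–Littlewood's
  Conjecture E and Landau's conjecture (`conjE_of_crux`, `landau_of_crux`).

rc 0 / 0 sorry on the farm today certifies that both certificates still elaborate against the
current tree (post-maintenance names), i.e. the first-generation verdicts carry over unchanged.
-/

namespace Summit.Parity.BatemanHorn.Cruxes.RoughValueLaw.ReauditC2

open Filter Finset Polynomial Asymptotics
open scoped Topology BigOperators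
open Literature.NumberTheory.Sieve
open Summit.Parity.BatemanHorn.Theses.RoughValueTransport

/-- S4 of line `increment-anchoring` (deep rung ratios, `3 ≤ u < U`), verbatim. -/
def DeepRatioLaw : Prop :=
  ∀ (k : ℕ) (f : Fin k → Polynomial ℤ), IsBatemanHornSystem f → ∀ ω : ℝ → ℝ,
      ((∀ u : ℝ, 1 ≤ u → u ≤ 2 → ω u = u⁻¹) ∧ ContinuousOn ω (Set.Ici 1) ∧
        (∀ u : ℝ, 2 < u → HasDerivAt (fun t : ℝ => t * ω t) (ω (u - 1)) u)) →
      ∀ u U : ℝ, 3 ≤ u → u < U →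
        Tendsto (fun x : ℕ =>
          (((Icc 1 x).filter (fun n : ℕ => ∀ i, 0 < (f i).eval (n : ℤ) ∧
              ∀ p ∈ range ⌈(x : ℝ) ^ (((f i).natDegree : ℝ) / u)⌉₊,
                p.Prime → ¬ ((p : ℤ) ∣ (f i).eval (n : ℤ)))).card : ℝ) /
          (((Icc 1 x).filter (fun n : ℕ => ∀ i, 0 < (f i).eval (n : ℤ) ∧
              ∀ p ∈ range ⌈(x : ℝ) ^ (((f i).natDegree : ℝ) / U)⌉₊,
                p.Prime → ¬ ((p : ℤ) ∣ (f i).eval (n : ℤ)))).card : ℝ)) atTop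
          (𝓝 ((u * ω u / (U * ω U)) ^ k))

/-- S5 of line `increment-anchoring` (shallow rung ratios against the rung `3`, `2 < u < 3`, ω-free),
verbatim. -/
def ShallowRatioLaw : Prop :=
  ∀ (k : ℕ) (f : Fin k → Polynomial ℤ), IsBatemanHornSystem f →
      ∀ u : ℝ, 2 < u → u < 3 →
        Tendsto (fun x : ℕ =>
          (((Icc 1 x).filter (fun n : ℕ => ∀ i, 0 < (f i).eval (n : ℤ) ∧
              ∀ p ∈ range ⌈(x : ℝ) ^ (((f i).natDegree : ℝ) / u)⌉₊,
                p.Prime → ¬ ((p : ℤ) ∣ (f i).eval (n : ℤ)))).card : ℝ) /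
          (((Icc 1 x).filter (fun n : ℕ => ∀ i, 0 < (f i).eval (n : ℤ) ∧
              ∀ p ∈ range ⌈(x : ℝ) ^ (((f i).natDegree : ℝ) / 3)⌉₊,
                p.Prime → ¬ ((p : ℤ) ∣ (f i).eval (n : ℤ)))).card : ℝ)) atTop
          (𝓝 (((1 + Real.log (u - 1)) / (1 + Real.log 2)) ^ k))

/-- The open stubs of line `increment-anchoring` are, jointly, the crux (p92159). -/
theorem openStubs_iff_crux : (DeepRatioLaw ∧ ShallowRatioLaw) ↔ RoughValueLaw :=
  IncrementAnchoring.roughValueLaw_iff_ratioLaws.symm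

/-- The crux proves the twin prime conjecture (p108123). -/
theorem twinPrimes_of_crux (h : RoughValueLaw) : TwinPrimeConjecture :=
  Strength.twinPrimeConjecture_of_roughValueLaw h

/-- The crux proves Hardy–Littlewood's Conjecture E (p108123). -/
theorem conjE_of_crux (h : RoughValueLaw) : HardyLittlewoodConjE :=
  Strength.hardyLittlewoodConjE_of_roughValueLaw h

/-- The crux proves Landau's conjecture on primes `n² + 1` (p108123). -/
theorem landau_of_crux (h : RoughValueLaw) : LandauConjecture :=
  Strength.landauConjecture_of_roughValueLaw h

/-- Hence any proof of the two open stubs of line `increment-anchoring` is a proof of the twin prime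
conjecture: the line cannot close short of Hardy–Littlewood. -/
theorem twinPrimes_of_openStubs (hS4 : DeepRatioLaw) (hS5 : ShallowRatioLaw) : TwinPrimeConjecture :=
  twinPrimes_of_crux (openStubs_iff_crux.mp ⟨hS4, hS5⟩)

/-- And already S5's companion for the single system `(X, X+2)` — i.e. the crux's conclusion for the
twin system alone — gives `π₂(x) ∼ 2C₂x/(log x)²` (p108123, per-system form). -/
theorem twinAsymptotic_of_twinRung
    (hR : ∀ ω : ℝ → ℝ, ((∀ u : ℝ, 1 ≤ u → u ≤ 2 → ω u = u⁻¹) ∧ ContinuousOn ω (Set.Ici 1) ∧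
        (∀ u : ℝ, 2 < u → HasDerivAt (fun t : ℝ => t * ω t) (ω (u - 1)) u)) →
      ∃ A : ℝ, ∀ u : ℝ, 2 < u → Tendsto (fun x : ℕ =>
        (((Finset.Icc 1 x).filter (fun n : ℕ => ∀ i, 0 < (twinSystem i).eval (n : ℤ) ∧
          ∀ p ∈ Finset.range ⌈(x : ℝ) ^ (((twinSystem i).natDegree : ℝ) / u)⌉₊,
            p.Prime → ¬ ((p : ℤ) ∣ (twinSystem i).eval (n : ℤ)))).card : ℝ) *
          Real.log x ^ 2 / (x : ℝ))
        atTop (𝓝 (A * (u * ω u) ^ 2))) :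
    (fun x : ℕ => (twinPrimeCount x : ℝ)) ~[atTop]
      fun x : ℕ => 2 * twinPrimeConst * x / Real.log x ^ 2 :=
  Strength.twinPrimeCount_isEquivalent_of_systemRoughValueLaw hR

end Summit.Parity.BatemanHorn.Cruxes.RoughValueLaw.ReauditC2
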